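import Summits.KontsevichZagierPeriods.KontsevichZagierPeriods.Theorems.LinRedNormalFormArrangementNormalFormSeparateSplitDominated
import Summits.KontsevichZagierPeriods.KontsevichZagierPeriods.Theorems.LinRedNormalFormArrangementNormalFormSeparateTaylor
import Summits.KontsevichZagierPeriods.KontsevichZagierPeriods.Theorems.LinRedNormalFormArrangementNormalFormSeparateDominated
import Summits.KontsevichZagierPeriods.KontsevichZagierPeriods.Theorems.LinRedNormalFormArrangementNormalFormSeparateBaseChange
import Summits.KontsevichZagierPeriods.KontsevichZagierPeriods.Theorems.LinRedNormalFormArrangementNormalFormSeparateTwoZeroCandidates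

/-!
# Separation with a numerator bounded away from zero (line `janus-bands`)

(Crux `ArrangementNormalForm`, stub `stub_separateHigh` — separation in base dimension `≥ 3`;
part `Carry`, valid in every base dimension.)

The separation engine `SeparatePos.sep_induction` run to the END of the pipeline
`JJ (b+1) k → GG♮ b k → GG b 1 k` for a GENERAL numerator `P(x', y)` that is BOUNDED AWAY FROM
ZERO on the (bounded) domain: the engine carries `P` unchanged (`separatePos_carry`), and in the
terminal single-pole shapes the Taylor pieces `qᵢ(x') (y − ℓ(x'))^i` of `P`
(`separatePos_taylor`) are bounded on the bounded domain, hence dominated by `C |P|`, so the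
numerator split `GG♮ → GG` is termwise absolutely convergent (`separatePos_split_dominated`).

* `separateHigh_carry` (registered part of `stub_separateHigh`): literal `JJ (b+1) k` data, the
  active `y`-letters non-vanishing on the domain, the RATIO condition for non-proportional pairs,
  `|P| ≥ c > 0` on the domain ⟹ `∃ c ∈ closure (GG b 1 k), [s] − c ∈ KZ.relations`;
* `separateHigh_direction` (registered part): the same after the rational base change of
  `separatePos_baseChange` making a rational direction `v` (last column of `A⁻¹`) the
  distinguished coordinate, hypotheses stated in the original coordinates (as in
  `separatePos_direction`); the lower bound on the numerator is transported through the
  substitution (`|det A⁻¹| · |P ∘ A⁻¹| ≥ |det A⁻¹| c`).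
-/

noncomputable section

open Set MeasureTheory MvPolynomial

namespace Summit.KontsevichZagierPeriods.ArrangementNormalForm.JanusBands

open Literature.NumberTheory.Transcendental

namespace SepHigh

open SeparatePos

/-- A polynomial function is bounded on a bounded set. [folklore] -/
theorem exists_bound_aeval {n : ℕ} (Q : MvPolynomial (Fin n) ℚ) {D : Set (Fin n → ℝ)}
    (hD : Bornology.IsBounded D) : ∃ C, ∀ z ∈ D, |MvPolynomial.aeval z Q| ≤ C := by
  have hc : Continuous fun z : Fin n → ℝ => MvPolynomial.aeval z Q :=
    Literature.ModelTheory.ExponentialFields.continuous_aeval_real Q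
  obtain ⟨C, hC⟩ := hD.isCompact_closure.exists_bound_of_continuousOn hc.continuousOn
  exact ⟨C, fun z hz => by simpa [Real.norm_eq_abs] using hC z (subset_closure hz)⟩

/-- The normalising constant `∏ lead` of the engine is non-zero. [folklore] -/
theorem prod_lead_ne_zero {b m : ℕ} (L : Fin m → (Fin (b + 1) → ℚ) × ℚ) (e : Fin m → ℕ) :
    (∏ j, lead b (L j) (e j)) ≠ 0 :=
  Finset.prod_ne_zero_iff.2 fun j _ => by
    unfold lead
    split_ifs with h
    · exact one_ne_zero
    · exact pow_ne_zero _ h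

/-- The Taylor piece `qᵢ(x') (y − ℓ(x'))^i` is a polynomial function of `z`. [folklore] -/
theorem taylor_piece_eq {b k : ℕ} (q : MvPolynomial (Fin b) ℚ) (ℓ : (Fin b → ℚ) × ℚ) (i : ℕ)
    (z : Fin (b + 1 + k) → ℝ) :
    MvPolynomial.aeval (fun i => z (Fin.castAdd k (Fin.castSucc i))) q *
      (z (Fin.castAdd k (Fin.last b)) - (∑ i, (ℓ.1 i : ℝ) * z (Fin.castAdd k (Fin.castSucc i)) +
        (ℓ.2 : ℝ))) ^ i =
    MvPolynomial.aeval z (rename (fun i => Fin.castAdd k (Fin.castSucc i)) q *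
      (X (Fin.castAdd k (Fin.last b)) - affPoly b k ℓ) ^ i) := by
  simp [aeval_rename, Function.comp_def, aeval_affPoly, affB]

end SepHigh

open SeparatePos SepHigh in
/-- **Separation with a numerator bounded away from zero** (registered part of
`stub_separateHigh`; every base dimension `b + 1`). Let `s` be a Janus band representation over
the base `ℝ^{b+1}` with `k` fibres (literal `JJ (b+1) k` data, ANY numerator
`p : MvPolynomial (Fin (b+1)) ℚ`) whose active `y`-letters (`(L j).1 (Fin.last b) ≠ 0`,
`e j ≠ 0`) do not vanish on the domain, which satisfies the RATIO condition
`|L_{j'}| ≤ C · |α_j L_{j'} − α_{j'} L_j|` on the domain for every ordered pair of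
non-proportional active letters, and whose numerator is bounded away from zero on the domain
(`|p| ≥ c > 0`). Then `[s]` is congruent modulo `KZ.relations` to a `ℤ`-combination of elements
of `GG b 1 k`: the engine `SeparatePos.sep_induction` with the numerator carried, and in the
terminal single-pole shapes the Taylor split `separatePos_split_dominated`, the Taylor pieces
being bounded on the bounded domain and hence dominated by `C |p|`.
[Kontsevich–Zagier 2001, §1.2] -/
theorem separateHigh_carry (GG : ℕ → ℕ → ℕ → Set KZ.FormalRep) (hGG : ∀ b σ k, GG b σ k = {w : KZ.FormalRep | ∃ (m m' n₁ n₂ : ℕ) (s : KZ.IntegralRep (b + 1 + k)) (M : Fin m' → (Fin (b + 1) → ℚ) × ℚ) (L : Fin m → (Fin b → ℚ) × ℚ) (e : Fin m → ℕ) (p : MvPolynomial (Fin b) ℚ) (ℓ₁ ℓ₂ : (Fin b → ℚ) × ℚ) (a : Fin k → Option ((Fin (b + 1) → ℚ) × ℚ)) (lo hi : Fin k → Fin k ⊕ ((Fin (b + 1) → ℚ) × ℚ)), (n₁ = 0 ∨ n₂ = 0) ∧ (σ = 2 → (∀ i c, a i = some c → c.1 (Fin.last b) = 0) ∧ (∀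 i c, (lo i = Sum.inr c ∨ hi i = Sum.inr c) → (c.1 (Fin.last b) = 0 ∨ c = (Pi.single (Fin.last b) 1, 0)))) ∧ Bornology.IsBounded s.domain ∧ s.domain = {z | (∀ j, 0 < ∑ i, ((M j).1 i : ℝ) * z (Fin.castAdd k i) + ((M j).2 : ℝ)) ∧ ∀ i, Sum.elim (fun j => z (Fin.natAdd (b + 1) j)) (fun c => ∑ i', (c.1 i' : ℝ) * z (Fin.castAdd k i') + (c.2 : ℝ)) (lo i) < z (Fin.natAdd (b + 1) i) ∧ z (Fin.natAdd (b + 1) i) < Sum.elim (fun j => z (Fin.natAdd (b + 1) j)) (fun c => ∑ i', (c.1 i' : ℝ) * z (Fin.castAdd k i') + (c.2 : ℝ)) (hi i)} ∧ EqOn s.integrand (fun z => MvPolynomial.aeval (fun i => z (Fin.castAdd k (Fin.castSucc i))) p / (∏ j, (∑ i, ((L j).1 i : ℝ) * z (Fin.castAdd k (Fin.castSucc i)) + ((L j).2 : ℝ)) ^ e j) * ((z (Fin.castAdd k (Fin.last b)) - (∑ i, (ℓ₁.1 i : ℝ) * z (Fin.castAdd k (Fin.castSucc i)) + (ℓ₁.2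 : ℝ))) ^ n₁ / (z (Fin.castAdd k (Fin.last b)) - (∑ i, (ℓ₂.1 i : ℝ) * z (Fin.castAdd k (Fin.castSucc i)) + (ℓ₂.2 : ℝ))) ^ n₂) * ∏ i, (a i).elim 1 (fun c => 1 / (z (Fin.natAdd (b + 1) i) - (∑ i', (c.1 i' : ℝ) * z (Fin.castAdd k i') + (c.2 : ℝ))))) s.domain ∧ w = KZ.of s}) (b k m m' : ℕ) (s : KZ.IntegralRep (b + 1 + k)) (M : Fin m' → (Fin (b + 1) → ℚ) × ℚ) (L : Fin m → (Fin (b + 1) → ℚ) × ℚ) (e : Fin m → ℕ) (p : MvPolynomial (Fin (b + 1)) ℚ) (a : Fin k → Option ((Fin (b + 1) → ℚ) × ℚ)) (lo hi : Fin k → Fin k ⊕ ((Fin (b + 1) → ℚ) × ℚ)) (hbd : Bornology.IsBounded s.domain) (hdom : s.domain = {z | (∀ j, 0 < ∑ i, ((M j).1 i : ℝ) * z (Fin.castAdd k i) + ((M j).2 : ℝ)) ∧ ∀ i, Sum.elim (fun j => z (Fin.natAdd (b + 1) j)) (fun c => ∑ i', (c.1 i' : ℝ) * z (Fin.castAdd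 k i') + (c.2 : ℝ)) (lo i) < z (Fin.natAdd (b + 1) i) ∧ z (Fin.natAdd (b + 1) i) < Sum.elim (fun j => z (Fin.natAdd (b + 1) j)) (fun c => ∑ i', (c.1 i' : ℝ) * z (Fin.castAdd k i') + (c.2 : ℝ)) (hi i)}) (hint : EqOn s.integrand (fun z => MvPolynomial.aeval (fun i => z (Fin.castAdd k i)) p / (∏ j, (∑ i, ((L j).1 i : ℝ) * z (Fin.castAdd k i) + ((L j).2 : ℝ)) ^ e j) * ∏ i, (a i).elim 1 (fun c => 1 / (z (Fin.natAdd (b + 1) i) - (∑ i', (c.1 i' : ℝ) * z (Fin.castAdd k i') + (c.2 : ℝ))))) s.domain) (hpole : ∀ j, (L j).1 (Fin.last b) ≠ 0 → e j ≠ 0 → ∀ z ∈ s.domain, ∑ i, ((L j).1 i : ℝ) * z (Fin.castAdd k i) + ((L j).2 : ℝ) ≠ 0) (hrat : ∀ j j', (L j).1 (Fin.last b) ≠ 0 → (L j').1 (Fin.last b) ≠ 0 → e j ≠ 0 → e j' ≠ 0 → (L j').1 (Fin.last b) • L j ≠ (L j).1 (Fin.last b) • L j' → ∃ C : ℝ,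 ∀ z ∈ s.domain, |∑ i, ((L j').1 i : ℝ) * z (Fin.castAdd k i) + ((L j').2 : ℝ)| ≤ C * |((L j).1 (Fin.last b) : ℝ) * (∑ i, ((L j').1 i : ℝ) * z (Fin.castAdd k i) + ((L j').2 : ℝ)) - ((L j').1 (Fin.last b) : ℝ) * (∑ i, ((L j).1 i : ℝ) * z (Fin.castAdd k i) + ((L j).2 : ℝ))|) (hnum : ∃ c : ℝ, 0 < c ∧ ∀ z ∈ s.domain, c ≤ |MvPolynomial.aeval (fun i => z (Fin.castAdd k i)) p|) : ∃ c ∈ AddSubgroup.closure (GG b 1 k), KZ.of s - c ∈ KZ.relations := by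
  obtain ⟨c₀, hc₀, hnum⟩ := hnum
  have hd : ∀ j, (if (L j).1 (Fin.last b) = 0 then 0 else e j) ≠ 0 →
      (L j).1 (Fin.last b) ≠ 0 ∧ e j ≠ 0 := by
    intro j hj
    by_cases h : (L j).1 (Fin.last b) = 0
    · simp [h] at hj
    · exact ⟨h, by simpa [h] using hj⟩
  -- the fixed numerator of the engine and its lower bound
  set P : MvPolynomial (Fin (b + 1)) ℚ := MvPolynomial.C (∏ j, lead b (L j) (e j))⁻¹ * p with hP
  set κ : ℝ := |(((∏ j, lead b (L j) (e j))⁻¹ : ℚ) : ℝ)| * c₀ with hκ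
  have hκpos : 0 < κ :=
    mul_pos (abs_pos.2 (by exact_mod_cast inv_ne_zero (prod_lead_ne_zero L e))) hc₀
  have hPnum : ∀ z ∈ s.domain, κ ≤ |MvPolynomial.aeval (fun i => z (Fin.castAdd k i)) P| := by
    intro z hz
    rw [hP, map_mul, MvPolynomial.aeval_C, abs_mul, eq_ratCast, hκ]
    exact mul_le_mul_of_nonneg_left (hnum z hz) (abs_nonneg _)
  -- the terminal class: congruent to `closure (GG b 1 k)`
  set T : Set KZ.FormalRep := {w | ∃ c ∈ AddSubgroup.closure (GG b 1 k), w - c ∈ KZ.relations}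
    with hTdef
  have hT : ∀ (n : ℕ) (L' : Fin n → (Fin b → ℚ) × ℚ) (e' : Fin n → ℕ) (d : Fin m → ℕ)
      (s' : KZ.IntegralRep (b + 1 + k)) (ℓ : (Fin b → ℚ) × ℚ), Bornology.IsBounded s'.domain →
      s'.domain = gDom b k m' M lo hi →
      EqOn s'.integrand (shape b k P L' e' (fun j => root b (L j)) d a) s'.domain →
      (∀ j, d j ≠ 0 → ∀ z ∈ s'.domain,
        z (Fin.castAdd k (Fin.last b)) - affB b k (root b (L j)) z ≠ 0) →
      (∀ j, d j ≠ 0 → root b (L j) = ℓ) → KZ.of s' ∈ T := by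
    intro n L' e' d s' ℓ hbd' hdom' hint' hpole' hℓ
    have hsub : s'.domain ⊆ s.domain := by
      rw [hdom', hdom]
      exact fun z hz => hz
    -- literal `GG♮` form of the terminal integrand
    have hint'' : EqOn s'.integrand (fun z => MvPolynomial.aeval (fun i => z (Fin.castAdd k i)) P /
        (∏ j, (∑ i, ((L' j).1 i : ℝ) * z (Fin.castAdd k (Fin.castSucc i)) + ((L' j).2 : ℝ)) ^
          e' j) * (1 / (z (Fin.castAdd k (Fin.last b)) - (∑ i, (ℓ.1 i : ℝ) *
          z (Fin.castAdd k (Fin.castSucc i)) + (ℓ.2 : ℝ))) ^ (∑ j, d j)) *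
        ∏ i, (a i).elim 1 (fun c => 1 / (z (Fin.natAdd (b + 1) i) -
          (∑ i', (c.1 i' : ℝ) * z (Fin.castAdd k i') + (c.2 : ℝ))))) s'.domain := by
      intro z hz
      rw [hint' hz]
      simp only [shape, fib, affB, one_div]
      congr 2
      rw [← Finset.prod_pow_eq_pow_sum, ← Finset.prod_inv_distrib]
      refine Finset.prod_congr rfl fun j _ => ?_
      by_cases hj : d j = 0
      · simp [hj]
      · rw [hℓ j hj]
    have hpole'' : (∑ j, d j) ≠ 0 → ∀ z ∈ s'.domain, z (Fin.castAdd k (Fin.last b)) -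
        (∑ i, (ℓ.1 i : ℝ) * z (Fin.castAdd k (Fin.castSucc i)) + (ℓ.2 : ℝ)) ≠ 0 := by
      intro hn z hz
      obtain ⟨j, -, hj⟩ := Finset.exists_ne_zero_of_sum_ne_zero hn
      have h := hpole' j hj z hz
      rwa [hℓ j hj] at h
    obtain ⟨N, q, hq⟩ := separatePos_taylor b k P ℓ
    -- domination of the `i`-th Taylor piece by `|P| ≥ κ`
    have hdomq : ∀ i ∈ Finset.range N, ∃ C : ℝ, ∀ z ∈ s'.domain,
        |MvPolynomial.aeval (fun i => z (Fin.castAdd k (Fin.castSucc i))) (q i) *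
          (z (Fin.castAdd k (Fin.last b)) - (∑ i, (ℓ.1 i : ℝ) * z (Fin.castAdd k (Fin.castSucc i)) +
            (ℓ.2 : ℝ))) ^ i| ≤ C * |MvPolynomial.aeval (fun i => z (Fin.castAdd k i)) P| := by
      intro i _
      obtain ⟨C, hC⟩ := exists_bound_aeval (rename (fun i => Fin.castAdd k (Fin.castSucc i)) (q i) *
        (X (Fin.castAdd k (Fin.last b)) - affPoly b k ℓ) ^ i) hbd'
      refine ⟨C / κ, fun z hz => ?_⟩
      rw [taylor_piece_eq, div_mul_eq_mul_div, le_div_iff₀ hκpos]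
      exact mul_le_mul (hC z hz) (hPnum z (hsub hz)) hκpos.le ((abs_nonneg _).trans (hC z hz))
    exact separatePos_split_dominated GG hGG b k n m' (∑ j, d j) s' M L' e' P ℓ
      a lo hi hpole'' hbd' hdom' hint'' N q hq hdomq
  -- the engine
  have hshape : EqOn s.integrand (shape b k P
      (fun j => if (L j).1 (Fin.last b) = 0 then restr b (L j) else (0, 1))
      (fun j => if (L j).1 (Fin.last b) = 0 then e j else 0) (fun j => root b (L j))
      (fun j => if (L j).1 (Fin.last b) = 0 then 0 else e j) a) s.domain := fun z hz => by
    rw [hint hz]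
    exact jshape_eq L e _ a z
  have hpole' : ∀ j, (if (L j).1 (Fin.last b) = 0 then 0 else e j) ≠ 0 → ∀ z ∈ s.domain,
      z (Fin.castAdd k (Fin.last b)) - affB b k (root b (L j)) z ≠ 0 := fun j hj z hz => by
    obtain ⟨hα, he⟩ := hd j hj
    have h := hpole j hα he z hz
    rw [show (∑ i, ((L j).1 i : ℝ) * z (Fin.castAdd k i) + ((L j).2 : ℝ)) = affF b k (L j) z
      from rfl, affF_of_ne_zero (L j) z hα] at h
    exact right_ne_zero_of_mul h
  have hrat' : ∀ j j', (if (L j).1 (Fin.last b) = 0 then 0 else e j) ≠ 0 →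
      (if (L j').1 (Fin.last b) = 0 then 0 else e j') ≠ 0 → root b (L j) ≠ root b (L j') →
      ∃ C, ∀ z ∈ s.domain, |z (Fin.castAdd k (Fin.last b)) - affB b k (root b (L j')) z| ≤
        C * |affB b k (root b (L j)) z - affB b k (root b (L j')) z| := fun j j' hj hj' hne => by
    obtain ⟨hα, he⟩ := hd j hj
    obtain ⟨hα', he'⟩ := hd j' hj'
    obtain ⟨C, hC⟩ := hrat j j' hα hα' he he' fun h => hne (root_eq_of_smul_eq hα hα' h)
    exact ⟨C * |((L j).1 (Fin.last b) : ℝ)|, fun z hz => ratio_of_literal (L j) (L j') hα hα' z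
      (hC z hz)⟩
  obtain ⟨c, hc, hsc⟩ := sep_induction b k m' m M P (fun j => root b (L j)) a lo hi T hT _ m
    _ _ _ s rfl hbd hdom hshape hpole' hrat'
  obtain ⟨c', hc', hcc⟩ := SepTwoZero.closure_transfer' (S := T)
    (T := GG b 1 k) (fun x hx => hx) c hc
  refine ⟨c', hc', ?_⟩
  have := add_mem hsc hcc
  rwa [sub_add_sub_cancel] at this


open SeparatePos SepHigh in
/-- **Separation along a rational direction, numerator bounded away from zero** (registered part
of `stub_separateHigh`; every base dimension `b + 2 ≥ 2`): `separatePos_baseChange` followed by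
`separateHigh_carry`. Let `s` be a Janus band representation (literal `JJ (b+2) k` data) and
`Ainv = A⁻¹` an invertible rational matrix whose last column is the new distinguished direction.
If every letter `L_j` with `∂ L_j = (vecMul L_j A⁻¹)_{last} ≠ 0` and `e_j ≠ 0` does not vanish on
the domain, the RATIO condition `|L_{j'}| ≤ C |∂L_j · L_{j'} − ∂L_{j'} · L_j|` holds on the domain
for every ordered pair of such letters that are not proportional, and the numerator is bounded
away from zero on the domain, then `[s]` is congruent modulo `KZ.relations` to a
`ℤ`-combination of elements of `GG (b+1) 1 k`. [Kontsevich–Zagier 2001, §1.2] -/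
theorem separateHigh_direction (GG : ℕ → ℕ → ℕ → Set KZ.FormalRep) (hGG : ∀ b σ k, GG b σ k = {w : KZ.FormalRep | ∃ (m m' n₁ n₂ : ℕ) (s : KZ.IntegralRep (b + 1 + k)) (M : Fin m' → (Fin (b + 1) → ℚ) × ℚ) (L : Fin m → (Fin b → ℚ) × ℚ) (e : Fin m → ℕ) (p : MvPolynomial (Fin b) ℚ) (ℓ₁ ℓ₂ : (Fin b → ℚ) × ℚ) (a : Fin k → Option ((Fin (b + 1) → ℚ) × ℚ)) (lo hi : Fin k → Fin k ⊕ ((Fin (b + 1) → ℚ) × ℚ)), (n₁ = 0 ∨ n₂ = 0) ∧ (σ = 2 → (∀ i c, a i = some c → c.1 (Fin.last b) = 0) ∧ (∀ i c, (lo i = Sum.inr c ∨ hi i = Sum.inr c) → (c.1 (Fin.last b) = 0 ∨ c = (Pi.single (Fin.last b) 1, 0)))) ∧ Bornology.IsBounded s.domain ∧ s.domain = {z | (∀ j, 0 < ∑ i, ((M j).1 i : ℝ) * z (Fin.castAdd k i) + ((M j).2 : ℝ)) ∧ ∀ i, Sum.elim (fun j => z (Fin.natAdd (b + 1) j)) (fun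 c => ∑ i', (c.1 i' : ℝ) * z (Fin.castAdd k i') + (c.2 : ℝ)) (lo i) < z (Fin.natAdd (b + 1) i) ∧ z (Fin.natAdd (b + 1) i) < Sum.elim (fun j => z (Fin.natAdd (b + 1) j)) (fun c => ∑ i', (c.1 i' : ℝ) * z (Fin.castAdd k i') + (c.2 : ℝ)) (hi i)} ∧ EqOn s.integrand (fun z => MvPolynomial.aeval (fun i => z (Fin.castAdd k (Fin.castSucc i))) p / (∏ j, (∑ i, ((L j).1 i : ℝ) * z (Fin.castAdd k (Fin.castSucc i)) + ((L j).2 : ℝ)) ^ e j) * ((z (Fin.castAdd k (Fin.last b)) - (∑ i, (ℓ₁.1 i : ℝ) * z (Fin.castAdd k (Fin.castSucc i)) + (ℓ₁.2 : ℝ))) ^ n₁ / (z (Fin.castAdd k (Fin.last b)) - (∑ i, (ℓ₂.1 i : ℝ) * z (Fin.castAdd k (Fin.castSucc i)) + (ℓ₂.2 : ℝ))) ^ n₂) * ∏ i, (a i).elim 1 (fun c => 1 / (z (Fin.natAdd (b + 1) i) - (∑ i', (c.1 i' : ℝ) * z (Fin.castAdd k i') + (c.2 : ℝ))))) s.domain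 ∧ w = KZ.of s}) (b k m m' : ℕ) (s : KZ.IntegralRep (b + 2 + k)) (M : Fin m' → (Fin (b + 2) → ℚ) × ℚ) (L : Fin m → (Fin (b + 2) → ℚ) × ℚ) (e : Fin m → ℕ) (p : MvPolynomial (Fin (b + 2)) ℚ) (a : Fin k → Option ((Fin (b + 2) → ℚ) × ℚ)) (lo hi : Fin k → Fin k ⊕ ((Fin (b + 2) → ℚ) × ℚ)) (hbd : Bornology.IsBounded s.domain) (hdom : s.domain = {z | (∀ j, 0 < ∑ i, ((M j).1 i : ℝ) * z (Fin.castAdd k i) + ((M j).2 : ℝ)) ∧ ∀ i, Sum.elim (fun j => z (Fin.natAdd (b + 2) j)) (fun c => ∑ i', (c.1 i' : ℝ) * z (Fin.castAdd k i') + (c.2 : ℝ)) (lo i) < z (Fin.natAdd (b + 2) i) ∧ z (Fin.natAdd (b + 2) i) < Sum.elim (fun j => z (Fin.natAdd (b + 2) j)) (fun c => ∑ i', (c.1 i' : ℝ) * z (Fin.castAdd k i') + (c.2 : ℝ)) (hi i)}) (hint : EqOn s.integrand (fun z => MvPolynomial.aeval (fun i => z (Fin.castAdd k i)) p / (∏ j,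 (∑ i, ((L j).1 i : ℝ) * z (Fin.castAdd k i) + ((L j).2 : ℝ)) ^ e j) * ∏ i, (a i).elim 1 (fun c => 1 / (z (Fin.natAdd (b + 2) i) - (∑ i', (c.1 i' : ℝ) * z (Fin.castAdd k i') + (c.2 : ℝ))))) s.domain) (A Ainv : Matrix (Fin (b + 2)) (Fin (b + 2)) ℚ) (hA : A * Ainv = 1) (hA' : Ainv * A = 1) (hpole : ∀ j, Matrix.vecMul (L j).1 Ainv (Fin.last (b + 1)) ≠ 0 → e j ≠ 0 → ∀ z ∈ s.domain, ∑ i, ((L j).1 i : ℝ) * z (Fin.castAdd k i) + ((L j).2 : ℝ) ≠ 0) (hrat : ∀ j j', Matrix.vecMul (L j).1 Ainv (Fin.last (b + 1)) ≠ 0 → Matrix.vecMul (L j').1 Ainv (Fin.last (b + 1)) ≠ 0 → e j ≠ 0 → e j' ≠ 0 → Matrix.vecMul (L j').1 Ainv (Fin.last (b + 1)) • L j ≠ Matrix.vecMul (L j).1 Ainv (Fin.last (b + 1)) • L j' → ∃ C : ℝ, ∀ z ∈ s.domain, |∑ i, ((L j').1 i : ℝ) * z (Fin.castAdd k i) + ((L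 j').2 : ℝ)| ≤ C * |((Matrix.vecMul (L j).1 Ainv (Fin.last (b + 1)) : ℚ) : ℝ) * (∑ i, ((L j').1 i : ℝ) * z (Fin.castAdd k i) + ((L j').2 : ℝ)) - ((Matrix.vecMul (L j').1 Ainv (Fin.last (b + 1)) : ℚ) : ℝ) * (∑ i, ((L j).1 i : ℝ) * z (Fin.castAdd k i) + ((L j).2 : ℝ))|) (hnum : ∃ c : ℝ, 0 < c ∧ ∀ z ∈ s.domain, c ≤ |MvPolynomial.aeval (fun i => z (Fin.castAdd k i)) p|) : ∃ c ∈ AddSubgroup.closure (GG (b + 1) 1 k), KZ.of s - c ∈ KZ.relations := by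
  obtain ⟨M', L', p', a', lo', hi', s', -, hL', hp', -, -, -, hΨ, hbd', hdom', hint', hrel⟩ :=
    separatePos_baseChange (b + 2) k m m' s M L e p a lo hi hbd hdom hint A Ainv hA hA'
  obtain ⟨c₀, hc₀, hnum⟩ := hnum
  have hdet : Ainv.det ≠ 0 := by
    intro h
    have h1 : A.det * Ainv.det = 1 := by rw [← Matrix.det_mul, hA, Matrix.det_one]
    rw [h, mul_zero] at h1
    exact zero_ne_one h1
  have hnum' : ∃ c : ℝ, 0 < c ∧ ∀ w ∈ s'.domain,
      c ≤ |MvPolynomial.aeval (fun i => w (Fin.castAdd k i)) p'| := by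
    refine ⟨|((|Ainv.det| : ℚ) : ℝ)| * c₀,
      mul_pos (abs_pos.2 (by exact_mod_cast abs_ne_zero.2 hdet)) hc₀, fun w hw => ?_⟩
    rw [hp', map_mul, MvPolynomial.aeval_C, eq_ratCast, aeval_bind_sub, abs_mul]
    exact mul_le_mul_of_nonneg_left (hnum _ ((hΨ w).1 hw)) (abs_nonneg _)
  refine (separateHigh_carry GG hGG (b + 1) k m m' s' M' L' e p' a' lo' hi' hbd' hdom'
    hint' (fun j hα he w hw => ?pole) (fun j j' hα hα' he he' hne => ?rat) hnum').imp
    fun c hc => ⟨hc.1, ?main⟩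
  case main =>
    have h := add_mem hrel hc.2
    rwa [sub_add_sub_cancel] at h
  case pole =>
    simp only [hL'] at hα ⊢
    have h := hpole j hα he _ ((hΨ w).1 hw)
    rwa [form_sub] at h
  case rat =>
    simp only [hL'] at hα hα' hne ⊢
    have hne' : Matrix.vecMul (L j').1 Ainv (Fin.last (b + 1)) • L j ≠
        Matrix.vecMul (L j).1 Ainv (Fin.last (b + 1)) • L j' := fun h => by
      have h2 := congrArg (fun c : (Fin (b + 2) → ℚ) × ℚ => (Matrix.vecMul c.1 Ainv, c.2)) h
      exact hne (by simpa only [Prod.smul_fst, Prod.smul_snd, Matrix.smul_vecMul, Prod.smul_mk]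
        using h2)
    obtain ⟨C, hC⟩ := hrat j j' hα hα' he he' hne'
    refine ⟨C, fun w hw => ?_⟩
    have h := hC _ ((hΨ w).1 hw)
    rwa [form_sub, form_sub] at h

end Summit.KontsevichZagierPeriods.ArrangementNormalForm.JanusBands
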